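import Mathlib
import Summits.Ventures.PercRepro.PuncturedLYMUnif67Table
import Summits.Ventures.PercRepro.PuncturedLYMUnif67Pos1
import Summits.Ventures.PercRepro.PuncturedLYMUnif67Pos2
import Summits.Ventures.PercRepro.PuncturedLYMUnif67Pos3
import Summits.Ventures.PercRepro.PuncturedLYMUnif67Pos4
import Summits.Ventures.PercRepro.PuncturedLYMUnif67Pos5
import Summits.Ventures.PercRepro.PuncturedLYMUnif67Pos6
import Summits.Ventures.PercRepro.PuncturedLYMUnif67Pos7
import Summits.Ventures.PercRepro.PuncturedLYMUnif67Pos8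
import Summits.Ventures.PercRepro.PuncturedLYMUnif67Pos9
import Summits.Ventures.PercRepro.PuncturedLYMUnif67Pos10
import Summits.Ventures.PercRepro.PuncturedLYMUnif67Pos11
import Summits.Ventures.PercRepro.PuncturedLYMUnif67Pos12
import Summits.Ventures.PercRepro.PuncturedLYMUnif67Pos13
import Summits.Ventures.PercRepro.PuncturedLYMUnif67Pos14
import Summits.Ventures.PercRepro.PuncturedLYMUnif67Pos15
import Summits.Ventures.PercRepro.PuncturedLYMUnif67Pos16
import Summits.Ventures.PercRepro.PuncturedLYMUnif67Pos17

/-!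
# PercRepro — (SP) FOR ANY NUMBER OF PAIRWISE DISJOINT `6`-SETS AT LEVEL `7`: POSITIVITY BY CLASS (2)
(p10, gen 41)

For each class, every direction's numerator is nonnegative on the class (`split_ifs` over the directions).  Nothing here asserts (SP).
-/

namespace PercRepro.PuncturedLYM.Split.TypeLift.Unif67

/-- The class `(3, 2, 0, 0, 0)`: every direction's numerator is nonnegative on the class. -/
theorem sel_32000_nonneg (n k : ℚ) (v : ℕ) (hk : 5 ≤ k) (hf : 0 ≤ n - 6 * k) : 0 ≤ sel_32000 v n k := by
  unfold sel_32000
  split_ifs with h1 h2 h3 h4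
  · exact N_32000_D0_nonneg n k hk hf
  · exact N_32000_D1_nonneg n k hk hf
  · exact N_32000_D2_nonneg n k hk hf
  · exact N_32000_F_nonneg n k hk hf
  · exact le_refl 0

/-- The class `(4, 0, 1, 0, 0)`: every direction's numerator is nonnegative on the class. -/
theorem sel_40100_nonneg (n k : ℚ) (v : ℕ) (hk : 5 ≤ k) (hf : 0 ≤ n - 6 * k) : 0 ≤ sel_40100 v n k := by
  unfold sel_40100
  split_ifs with h1 h2 h3 h4
  · exact N_40100_D0_nonneg n k hk hf
  · exact N_40100_D1_nonneg n k hk hf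
  · exact N_40100_D3_nonneg n k hk hf
  · exact N_40100_F_nonneg n k hk hf
  · exact le_refl 0

/-- The class `(5, 1, 0, 0, 0)`: every direction's numerator is nonnegative on the class. -/
theorem sel_51000_nonneg (n k : ℚ) (v : ℕ) (hk : 6 ≤ k) (hf : 0 ≤ n - 6 * k) : 0 ≤ sel_51000 v n k := by
  unfold sel_51000
  split_ifs with h1 h2 h3 h4
  · exact N_51000_D0_nonneg n k hk hf
  · exact N_51000_D1_nonneg n k hk hf
  · exact N_51000_D2_nonneg n k hk hf
  · exact N_51000_F_nonneg n k hk hf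
  · exact le_refl 0

/-- The class `(7, 0, 0, 0, 0)`: every direction's numerator is nonnegative on the class. -/
theorem sel_70000_nonneg (n k : ℚ) (v : ℕ) (hk : 7 ≤ k) (hf : 0 ≤ n - 6 * k) : 0 ≤ sel_70000 v n k := by
  unfold sel_70000
  split_ifs with h1 h2 h3
  · exact N_70000_D0_nonneg n k hk hf
  · exact N_70000_D1_nonneg n k hk hf
  · exact N_70000_F_nonneg n k hk hf
  · exact le_refl 0

end PercRepro.PuncturedLYM.Split.TypeLift.Unif67
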